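import Summits.BirchSwinnertonDyer.BirchSwinnertonDyer.Theorems.AdditiveBranchIMCGordTwoRankOneSmallImageDickson
import Literature.NumberTheory.EllipticCurves.IrreducibleModPQuadraticTwistProofs
import Literature.NumberTheory.EllipticCurves.BSDSelmerPConverseSerreProofs
import HarnessLib

/-!
# Route `AdditiveBranchIMC` (rung K1), crux `GordTwoRankOne` (item 19358), small-image rows — the twist passage
# for Serre's Prop. 15: `p ∣ #ρ̄_{E^d}(Γ_ℚ) ⟹ p ∣ #ρ̄_E(Γ_ℚ)` (`p` odd), hence clause (i) of p547579 for the
# Friedberg–Hoffstein twist `Wd` from `E[p]` irreducible and `ρ̄_{E,p}` not onto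
# (cell `bsd-addord`, seat w2-acc5 gen 8; `--supports 19358`, helper; sequel of `…SmallImageDickson`)

HONEST FRAMING.  THEOREMS ONLY (no definition, no named fact, no instance, no `sorry`); nothing is booked; the
crux stays OPEN; «BSD is not proved by any of this».  Everything is PROVED: the inputs are the tree's
sign-equivariant twist isomorphism `exists_addEquiv_geomPoints_quadraticTwist_signed` (Silverman *AEC* X.5
Cor. 5.4), the equivariant change-of-equation isomorphism `VariableChange.pointEquivBaseChange`, and the
preceding file's `not_dvd_card_aut_divisionField` / `natCard_aut_divisionField_eq` (Serre Prop. 15 framed, the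
TREE's `not_dvd_card_of_not_hasSurjectiveModNGaloisRep`).

WHAT.  p547579's certificate clause (i) is about the TWIST `Wd` (`Cd • W.quadraticTwist d = Wd`) while the
row's image hypotheses (`E[p]` irreducible, `ρ̄_{E,p}` not onto) are about `W`.  Over `ℚ(√d)` the two mod-`p`
representations agree, and `ρ̄_{Wd} ≅ ρ̄_W ⊗ χ_d`; for `p` odd this does not change `p ∣ #image`:

* `dvd_card_range_galoisRepTorsion_of_addEquiv_signed` — for ANY additive isomorphism
  `f : E'(ℚ̄) ≃+ E(ℚ̄)` that is `Γ_ℚ`-equivariant UP TO A SIGN depending on `σ` only, and `p` odd: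
  `p ∣ #ρ̄_{E',p}(Γ_ℚ) ⟹ p ∣ #ρ̄_{E,p}(Γ_ℚ)`.  Proof: an element `ρ̄'(σ₀)` of order `p` has `ρ̄'(σ₀²)` of
  order `p` (`p` odd), squares are GENUINELY equivariant through `f` (`(±1)² = 1`), so `ρ̄(σ₀²)` has order `p`
  on `E[p]` as well (`orderOf_dvd_natCard`);
* `dvd_card_range_galoisRepTorsion_of_smul_eq_quadraticTwist` — the case `C • Wd = W^{(d)}`… here in the
  consumer's orientation `Cd • W.quadraticTwist d = Wd`: `p ∣ #ρ̄_{Wd}(Γ_ℚ) ⟹ p ∣ #ρ̄_W(Γ_ℚ)`;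
* ★ `not_dvd_card_aut_divisionField_of_smul_eq_quadraticTwist` — **clause (i) of p547579 for the twist**:
  `p ≠ 2 → Cd • W.quadraticTwist d = Wd → W.HasIrreducibleModPGaloisRep p → ¬ W.HasSurjectiveModNGaloisRep p →
  ¬ p ∣ Nat.card (Wd.divisionField p ≃ₐ[ℚ] Wd.divisionField p)`;
* ★ `…_of_five_le` — the same from the row's `¬ ∀ n, W.HasSurjectiveModNGaloisRep (p ^ n)` at `p ≥ 5` (Serre's
  lifting lemma, tree theorem `serre_hasSurjectiveModNGaloisRep_pow_holds`).

USE (k1-c3x successor): in `hClsm` of p547579 the row carries `¬ (∀ n, W.HasSurjectiveModNGaloisRep (p ^ n))`;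
clause (i) needs the LEVEL-ONE non-surjectivity `¬ W.HasSurjectiveModNGaloisRep p` (for a 3-adically defective
row that is onto mod `3`, `3 ∣ #GL₂(𝔽₃) = #Gal(ℚ(Wd[3])/ℚ)` and (i) is false) — on every O8 image at `p ≥ 5`
and on 3Ns/3Nn the two coincide (README B7/O8); `p = 2` is outside `hDRS` (`hc2.1`).

References: Serre, Invent. Math. 15 (1972) §2.4 Prop. 15 [Serre1972]; Silverman, *AEC* (2009) X.5 Cor. 5.4,
X.2 Prop. 2.4 [SilvermanAEC2009]; Deo–Ray–Sujatha (2023) Thm. 3.9, Lemma 5.1 [DeoRaySujatha2023].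
-/

set_option autoImplicit false
set_option linter.dupNamespace false
noncomputable section

open scoped Classical
open Field WeierstrassCurve
  Literature.NumberTheory.EllipticCurves Literature.NumberTheory.GaloisRepresentations

namespace Summit.BirchSwinnertonDyer.BirchSwinnertonDyer.Theorems.AdditiveBranchIMCGordTwoRankOne.SmallImageDickson

variable (p : ℕ) [hp : Fact p.Prime]

/-! ## §1 Transport of `p ∣ #image` along a sign-equivariant isomorphism (`p` odd) -/

/-- **`p ∣ #ρ̄_{E',p}(Γ_ℚ) ⟹ p ∣ #ρ̄_{E,p}(Γ_ℚ)` along a sign-equivariant additive isomorphism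
`f : E'(ℚ̄) ≃+ E(ℚ̄)`** (`f (σ • P) = ε(σ) σ • f P`, `ε(σ) = ±1` depending on `σ` only), for `p` odd: an
element `ρ̄'(σ₀)` of order `p` gives `ρ̄'(σ₀²)` of order `p`, squares commute with `f` on the nose, so `ρ̄(σ₀²)`
has order `p`.  (`E` elliptic makes `E[p]`, hence `E'[p]`, finite.) [cite: Serre1972, §2.4 Prop. 15]
[cite: SilvermanAEC2009, X.5 Cor. 5.4] -/
theorem dvd_card_range_galoisRepTorsion_of_addEquiv_signed (W W' : WeierstrassCurve ℚ) [W.IsElliptic]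
    (hp2 : p ≠ 2) (f : geomPoints W' ≃+ geomPoints W)
    (hf : ∀ σ : absoluteGaloisGroup ℚ, (∀ P, f (σ • P) = σ • f P) ∨ (∀ P, f (σ • P) = -(σ • f P)))
    (hdvd : p ∣ Nat.card (galoisRepTorsion W' p).range) :
    p ∣ Nat.card (galoisRepTorsion W p).range := by
  -- squares are genuinely equivariant
  have hsq : ∀ (σ : absoluteGaloisGroup ℚ) (P : geomPoints W'), f ((σ * σ) • P) = (σ * σ) • f P := by
    intro σ P
    rw [mul_smul, mul_smul]
    rcases hf σ with h | h
    · rw [h, h]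
    · rw [h, h, smul_neg, neg_neg]
  -- torsion is preserved
  have htor : ∀ {P : geomPoints W'}, P ∈ geomTorsion W' p ↔ f P ∈ geomTorsion W p := by
    intro P
    rw [geomTorsion, geomTorsion, AddSubgroup.torsionBy.nsmul_iff, AddSubgroup.torsionBy.nsmul_iff,
      ← map_nsmul, AddEquiv.map_eq_zero_iff]
  -- finiteness of `E'[p]` and of its automorphism group
  haveI : Finite (geomTorsion W p) := W.finite_geomTorsion_nat hp.out.ne_zero
  haveI : Finite (geomTorsion W' p) :=
    Finite.of_injective (fun T' : geomTorsion W' p ↦ (⟨f T', htor.mp T'.2⟩ : geomTorsion W p))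
      (fun a b h ↦ Subtype.ext (f.injective (congrArg Subtype.val h)))
  haveI : Finite (Multiplicative (AddAut (geomTorsion W' p))) :=
    Finite.of_injective (fun e : Multiplicative (AddAut (geomTorsion W' p)) ↦ ⇑(Multiplicative.toAdd e))
      (fun a c h ↦ by
        apply Multiplicative.toAdd.injective
        exact AddEquiv.ext (congrFun h))
  -- an element of order `p` in the image of `ρ̄'`
  obtain ⟨g, hg⟩ := exists_prime_orderOf_dvd_card' (G := (galoisRepTorsion W' p).range) p hdvd
  obtain ⟨σ₀, hσ₀⟩ := g.2
  have hord : orderOf (galoisRepTorsion W' p σ₀) = p := by rw [hσ₀, Subgroup.orderOf_coe, hg]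
  have ha1 : ∀ T' : geomTorsion W' p, (σ₀ ^ p) • T' = T' := by
    have h1 := pow_orderOf_eq_one (galoisRepTorsion W' p σ₀)
    rw [hord, ← map_pow] at h1
    exact (galoisRepTorsion_eq_one_iff_forall W' p _).mp h1
  have ha2 : ¬ ∀ T' : geomTorsion W' p, (σ₀ * σ₀) • T' = T' := by
    intro h
    have h1 : galoisRepTorsion W' p σ₀ ^ 2 = 1 := by
      rw [← map_pow, pow_two]
      exact (galoisRepTorsion_eq_one_iff_forall W' p _).mpr h
    have h2 : p ∣ 2 := by rw [← hord]; exact orderOf_dvd_of_pow_eq_one h1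
    exact hp2 ((Nat.prime_dvd_prime_iff_eq hp.out Nat.prime_two).mp h2)
  -- `τ = σ₀²` acts with order `p` on `E[p]`
  set τ : absoluteGaloisGroup ℚ := σ₀ * σ₀ with hτ
  have hb1 : ∀ T : geomTorsion W p, (τ ^ p) • T = T := by
    intro T
    have hT' : f.symm (T : geomPoints W) ∈ geomTorsion W' p := by rw [htor, f.apply_symm_apply]; exact T.2
    have hfix : (σ₀ ^ p) • f.symm (T : geomPoints W) = f.symm (T : geomPoints W) := by
      have h := congrArg (fun Q : geomTorsion W' p ↦ (Q : geomPoints W')) (ha1 ⟨_, hT'⟩)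
      simpa only [AddSubgroup.torsionBy.coe_smul] using h
    apply Subtype.ext
    rw [AddSubgroup.torsionBy.coe_smul, hτ, (Commute.refl σ₀).mul_pow, ← f.apply_symm_apply (T : geomPoints W),
      ← hsq, mul_smul, hfix, hfix]
  have hb2 : ∃ T : geomTorsion W p, τ • T ≠ T := by
    by_contra h
    push Not at h
    apply ha2
    intro T'
    have h1 := congrArg (fun Q : geomTorsion W p ↦ (Q : geomPoints W)) (h ⟨f T', htor.mp T'.2⟩)
    simp only [AddSubgroup.torsionBy.coe_smul] at h1
    rw [← hsq] at h1
    exact Subtype.ext (by rw [AddSubgroup.torsionBy.coe_smul]; exact f.injective h1)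
  have hg1p : galoisRepTorsion W p τ ^ p = 1 := by
    rw [← map_pow]
    exact (galoisRepTorsion_eq_one_iff_forall W p _).mpr hb1
  have hg1 : galoisRepTorsion W p τ ≠ 1 := by
    intro h
    obtain ⟨T, hT⟩ := hb2
    exact hT ((galoisRepTorsion_eq_one_iff_forall W p τ).mp h T)
  have hmem : galoisRepTorsion W p τ ∈ (galoisRepTorsion W p).range := ⟨τ, rfl⟩
  have hordτ : orderOf (⟨galoisRepTorsion W p τ, hmem⟩ : (galoisRepTorsion W p).range) = p := by
    rw [← Subgroup.orderOf_coe (⟨galoisRepTorsion W p τ, hmem⟩ : (galoisRepTorsion W p).range)]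
    exact orderOf_eq_prime hg1p hg1
  have hdvd' := orderOf_dvd_natCard (⟨galoisRepTorsion W p τ, hmem⟩ : (galoisRepTorsion W p).range)
  rwa [hordτ] at hdvd'

/-! ## §2 Quadratic twists over `ℚ` -/

/-- **`p ∣ #ρ̄_{Wd}(Γ_ℚ) ⟹ p ∣ #ρ̄_W(Γ_ℚ)`** for a model `Wd` of a quadratic twist of `W`
(`Cd • W.quadraticTwist d = Wd`, `d ≠ 0`, `p` odd): compose the equivariant change-of-equation
isomorphism `pointEquivBaseChange` with the sign-equivariant twist isomorphism
`exists_addEquiv_geomPoints_quadraticTwist_signed`. [cite: SilvermanAEC2009, X.5 Cor. 5.4 and X.2 Prop. 2.4] -/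
theorem dvd_card_range_galoisRepTorsion_of_smul_eq_quadraticTwist (W Wd : WeierstrassCurve ℚ) [W.IsElliptic]
    (hp2 : p ≠ 2) {d : ℚ} (hd : d ≠ 0) {Cd : VariableChange ℚ} (hWd : Cd • W.quadraticTwist d = Wd)
    (hdvd : p ∣ Nat.card (galoisRepTorsion Wd p).range) :
    p ∣ Nat.card (galoisRepTorsion W p).range := by
  subst hWd
  haveI : NeZero (2 : ℚ) := ⟨two_ne_zero⟩
  obtain ⟨f, hf⟩ := W.exists_addEquiv_geomPoints_quadraticTwist_signed hd
  let e : geomPoints (W.quadraticTwist d) ≃+ geomPoints (Cd • W.quadraticTwist d) :=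
    VariableChange.pointEquivBaseChange (W.quadraticTwist d) Cd (AlgebraicClosure ℚ)
  have he : ∀ (σ : absoluteGaloisGroup ℚ) (P : geomPoints (W.quadraticTwist d)), e (σ • P) = σ • e P :=
    fun σ P ↦ VariableChange.pointEquivBaseChange_map_algEquiv (W.quadraticTwist d) Cd
      (absoluteGaloisGroup.toAlgEquiv ℚ σ) P
  have he' : ∀ (σ : absoluteGaloisGroup ℚ) (Q : geomPoints (Cd • W.quadraticTwist d)),
      e.symm (σ • Q) = σ • e.symm Q := by
    intro σ Q
    apply e.injective
    rw [e.apply_symm_apply, he, e.apply_symm_apply]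
  refine dvd_card_range_galoisRepTorsion_of_addEquiv_signed p W (Cd • W.quadraticTwist d) hp2
    (e.symm.trans f) (fun σ ↦ ?_) hdvd
  rcases hf σ with h | h
  · exact Or.inl fun P ↦ by rw [AddEquiv.trans_apply, AddEquiv.trans_apply, he', h]
  · exact Or.inr fun P ↦ by rw [AddEquiv.trans_apply, AddEquiv.trans_apply, he', h]

/-- ★ **Clause (i) of p547579 for the twist**: for `W/ℚ` elliptic, an odd prime `p` with `E[p]` irreducible
and `ρ̄_{E,p}` NOT surjective, and any model `Wd` of a quadratic twist (`Cd • W.quadraticTwist d = Wd`, `d ≠ 0`;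
in p547579: `d = disc K` of the Heegner field), `p ∤ #Gal(ℚ(Wd[p])/ℚ)`.
[cite: Serre1972, §2.4 Prop. 15] [cite: SilvermanAEC2009, X.5 Cor. 5.4] [cite: DeoRaySujatha2023, §5 Lemma 5.1] -/
theorem not_dvd_card_aut_divisionField_of_smul_eq_quadraticTwist (W Wd : WeierstrassCurve ℚ) [W.IsElliptic]
    [Wd.IsElliptic] [NeZero p] (hp2 : p ≠ 2) {d : ℚ} (hd : d ≠ 0) {Cd : VariableChange ℚ}
    (hWd : Cd • W.quadraticTwist d = Wd) (hirr : W.HasIrreducibleModPGaloisRep p)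
    (hns : ¬ W.HasSurjectiveModNGaloisRep p) :
    ¬ p ∣ Nat.card (Wd.divisionField p ≃ₐ[ℚ] Wd.divisionField p) := by
  rw [natCard_aut_divisionField_eq]
  intro h
  have hW := dvd_card_range_galoisRepTorsion_of_smul_eq_quadraticTwist p W Wd hp2 hd hWd h
  rw [← natCard_aut_divisionField_eq] at hW
  exact not_dvd_card_aut_divisionField W p hirr hns hW

/-- ★ **The same in the EXACT row shape of p547579's `hClsm` at `p ≥ 5`**: there the small-image hypothesis is
`¬ ∀ n, W.HasSurjectiveModNGaloisRep (p ^ n)`; for `p ≥ 5` Serre's lifting lemma (tree theorem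
`serre_hasSurjectiveModNGaloisRep_pow_holds`: onto mod `p` ⟹ onto mod `pⁿ`) turns it into `¬ W.HasSurjectiveModNGaloisRep p`,
so clause (i) for the twist follows from the row hypotheses alone.  (At `p = 3` use the previous theorem with the
level-one hypothesis: 3Ns/3Nn rows; the 9-defective-but-onto-mod-3 rows are genuinely excluded.)
[cite: Serre1972, §2.4 Prop. 15] [cite: SerreAbelianLadic1968, Ch. IV §3.4] [cite: DeoRaySujatha2023, §5 Lemma 5.1] -/
theorem not_dvd_card_aut_divisionField_of_smul_eq_quadraticTwist_of_five_le (W Wd : WeierstrassCurve ℚ)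
    [W.IsElliptic] [Wd.IsElliptic] [NeZero p] (hp5 : 5 ≤ p) {d : ℚ} (hd : d ≠ 0) {Cd : VariableChange ℚ}
    (hWd : Cd • W.quadraticTwist d = Wd) (hirr : W.HasIrreducibleModPGaloisRep p)
    (hns : ¬ ∀ n : ℕ, W.HasSurjectiveModNGaloisRep (p ^ n : ℕ)) :
    ¬ p ∣ Nat.card (Wd.divisionField p ≃ₐ[ℚ] Wd.divisionField p) :=
  not_dvd_card_aut_divisionField_of_smul_eq_quadraticTwist p W Wd (by omega) hd hWd hirr
    fun h ↦ hns (serre_hasSurjectiveModNGaloisRep_pow_holds W p hp5 h)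

end Summit.BirchSwinnertonDyer.BirchSwinnertonDyer.Theorems.AdditiveBranchIMCGordTwoRankOne.SmallImageDickson

end
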